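import Mathlib
import Summits.KontsevichZagierPeriods.KontsevichZagierPeriods.Theorems.SoloInformedCubeWord
import Summits.KontsevichZagierPeriods.KontsevichZagierPeriods.Theorems.SoloInformedHarmonicGQ
import HarnessLib
import HarnessLib.Audit

/-!
# SoloInformed — block ends of an index, the letters `1` of its word, and `F_ε = G(Q)`

Solo programme `solo-KontsevichZagierPeriods-informed`, session s47 (PROGRAMME XLVI, file 3).

For an index `u = (u₁,…,u_k)` the BLOCK ENDS are the partial sums `J_r = u₁ + ⋯ + u_r`
(`soloInformedEnds u = [J₁,…,J_k]`).  The letters `1` of the binary word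
`0^{u₁-1}1⋯0^{u_k-1}1` sit exactly at the positions `J_r − 1` (`soloInformed_getD_binaryWord`),
and consequently the cube integrand of `SoloInformedCubeWord` is the chain function of
`SoloInformedHarmonicGQ` evaluated at the prefix products at the block ends:

  `F_{ε(u)}(x) = G(P_{J₁−1}(x), …, P_{J_k−1}(x))`     (`soloInformed_cubeWf_eq_GQ`),

`P_j(x) = x₀⋯x_j` (`soloInformedPP`, the `ℕ`-indexed prefix product).  This is the bridge between
the word side (rule (2) along `κ`, file 1) and the harmonic-sum side (the rational identity,
file 2) of PROGRAMME XLVI.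

References: Zagier 1994 §9; Hoffman 1992 §2; Kontsevich–Zagier 2001 §1.2.
-/

noncomputable section

open Literature.NumberTheory.Transcendental
open Literature.NumberTheory.Transcendental.KZ

namespace Summit.KontsevichZagierPeriods.KontsevichZagierPeriods.Theorems

/-! ## 1. Block ends -/

/-- The block ends (partial sums) `[u₁, u₁+u₂, …, u₁+⋯+u_k]` of an index. -/
def soloInformedEnds : List ℕ → List ℕ
  | [] => []
  | a :: s => a :: (soloInformedEnds s).map (a + ·)

/-- Ends of the empty index. -/
@[simp] theorem soloInformedEnds_nil : soloInformedEnds [] = [] := rfl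

/-- Ends of `a :: s`. -/
@[simp] theorem soloInformedEnds_cons (a : ℕ) (s : List ℕ) :
    soloInformedEnds (a :: s) = a :: (soloInformedEnds s).map (a + ·) := rfl

/-- There are as many ends as blocks. -/
@[simp] theorem soloInformed_length_ends : ∀ u : List ℕ, (soloInformedEnds u).length = u.length
  | [] => rfl
  | a :: s => by simp [soloInformed_length_ends s]

/-- **The `r`-th end is the partial sum `u₁ + ⋯ + u_{r+1}`.** -/
theorem soloInformed_ends_getElem : ∀ (u : List ℕ) (r : ℕ) (hr : r < (soloInformedEnds u).length),
    (soloInformedEnds u)[r] = (u.take (r + 1)).sum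
  | [], r, hr => by simp at hr
  | a :: s, 0, _ => by simp
  | a :: s, r + 1, hr => by
    have hr' : r < (soloInformedEnds s).length := by simpa using hr
    simp [soloInformed_ends_getElem s r hr', List.take_succ_cons, List.sum_cons]

/-- The `r`-th end via `getD`. -/
theorem soloInformed_ends_getD {u : List ℕ} {r : ℕ} (hr : r < u.length) :
    (soloInformedEnds u).getD r 0 = (u.take (r + 1)).sum := by
  rw [List.getD_eq_getElem _ _ (by simpa using hr), soloInformed_ends_getElem]

/-- Consecutive ends differ by the next entry. -/
theorem soloInformed_ends_getD_succ {u : List ℕ} {r : ℕ} (hr : r + 1 < u.length) :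
    (soloInformedEnds u).getD (r + 1) 0 = (soloInformedEnds u).getD r 0 + u[r + 1] := by
  rw [soloInformed_ends_getD hr, soloInformed_ends_getD (by omega), List.sum_take_succ _ _ hr]

/-- The ends strictly increase when all entries are positive. -/
theorem soloInformed_ends_getD_lt {u : List ℕ} (hpos : ∀ i ∈ u, 1 ≤ i) {r s : ℕ} (hrs : r < s)
    (hs : s < u.length) : (soloInformedEnds u).getD r 0 < (soloInformedEnds u).getD s 0 := by
  induction s with
  | zero => omega
  | succ s ih =>
    rw [soloInformed_ends_getD_succ hs]
    have h1 : 1 ≤ u[s + 1] := hpos _ (List.getElem_mem _)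
    rcases Nat.lt_succ_iff_lt_or_eq.1 hrs with h | rfl
    · have := ih h (by omega); omega
    · omega

/-- The ends are monotone. -/
theorem soloInformed_ends_getD_le {u : List ℕ} (hpos : ∀ i ∈ u, 1 ≤ i) {r s : ℕ} (hrs : r ≤ s)
    (hs : s < u.length) : (soloInformedEnds u).getD r 0 ≤ (soloInformedEnds u).getD s 0 := by
  rcases hrs.lt_or_eq with h | rfl
  · exact (soloInformed_ends_getD_lt hpos h hs).le
  · exact le_rfl

/-- The first end is `u₁ ≥ 1`, hence every end is `≥ 1`. -/
theorem soloInformed_one_le_ends_getD {u : List ℕ} (hpos : ∀ i ∈ u, 1 ≤ i) {r : ℕ} (hr : r < u.length) :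
    1 ≤ (soloInformedEnds u).getD r 0 := by
  have h0 : (soloInformedEnds u).getD 0 0 = u[0]'(by omega) := by
    rw [soloInformed_ends_getD (by omega)]
    obtain ⟨a, s, rfl⟩ := List.exists_cons_of_length_pos (by omega : 0 < u.length)
    simp
  have h1 : 1 ≤ (soloInformedEnds u).getD 0 0 := by rw [h0]; exact hpos _ (List.getElem_mem _)
  exact h1.trans (soloInformed_ends_getD_le hpos (Nat.zero_le r) hr)

/-- **The last end is the weight.** -/
theorem soloInformed_ends_getD_last {u : List ℕ} {k : ℕ} (hk : u.length = k + 1) :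
    (soloInformedEnds u).getD k 0 = u.sum := by
  rw [soloInformed_ends_getD (by omega), List.take_of_length_le (by omega)]

/-- Membership in the ends. -/
theorem soloInformed_mem_ends_iff {u : List ℕ} {j : ℕ} :
    j ∈ soloInformedEnds u ↔ ∃ r < u.length, (soloInformedEnds u).getD r 0 = j := by
  rw [List.mem_iff_getElem]
  constructor
  · rintro ⟨r, hr, h⟩
    exact ⟨r, by simpa using hr, by rw [List.getD_eq_getElem _ _ hr, h]⟩
  · rintro ⟨r, hr, h⟩
    exact ⟨r, by simpa using hr, by rw [← h, List.getD_eq_getElem _ _ (by simpa using hr)]⟩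

/-! ## 2. The letters `1` of the binary word -/

/-- **Position `j` of the word of `u` carries the letter `1` iff `j + 1` is a block end.** -/
theorem soloInformed_getD_binaryWord : ∀ (u : List ℕ), (∀ i ∈ u, 1 ≤ i) → ∀ j : ℕ,
    (MZV.binaryWord u).getD j false = decide (j + 1 ∈ soloInformedEnds u)
  | [], _, j => by simp [MZV.binaryWord]
  | a :: s, hpos, j => by
    have ha : 1 ≤ a := hpos a (by simp)
    have hs : ∀ i ∈ s, 1 ≤ i := fun i hi => hpos i (List.mem_cons_of_mem a hi)
    have hw : MZV.binaryWord (a :: s) = List.replicate (a - 1) false ++ (true :: MZV.binaryWord s) := by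
      simp [MZV.binaryWord]
    rw [hw, soloInformed_getD_replicate_false_append]
    split_ifs with hj
    · symm
      simp only [decide_eq_false_iff_not, soloInformedEnds_cons, List.mem_cons, List.mem_map, not_or,
        not_exists, not_and]
      exact ⟨by omega, fun e _ => by omega⟩
    · rcases Nat.eq_or_lt_of_le (Nat.le_of_not_lt hj) with hj' | hj'
      · rw [← hj', Nat.sub_self, List.getD_cons_zero]
        symm
        simp only [decide_eq_true_eq, soloInformedEnds_cons, List.mem_cons]
        exact Or.inl (by omega)
      · obtain ⟨i, hi⟩ : ∃ i, j - (a - 1) = i + 1 := ⟨j - a, by omega⟩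
        rw [hi, List.getD_cons_succ, soloInformed_getD_binaryWord s hs i]
        have hij : i = j - a := by omega
        subst hij
        simp only [soloInformedEnds_cons, List.mem_cons, List.mem_map, decide_eq_decide]
        constructor
        · intro h
          exact Or.inr ⟨j - a + 1, h, by omega⟩
        · rintro (h | ⟨e, he, h⟩)
          · omega
          · have : e = j - a + 1 := by omega
            subst this
            exact he

/-- The word function of `SoloInformedCubeWord` at a position below the top. -/
theorem soloInformed_wordFn_castSucc {m : ℕ} {u : List ℕ} (hpos : ∀ i ∈ u, 1 ≤ i) (i : Fin m) :
    soloInformedWordFn u m (Fin.castSucc i) = decide (i.1 + 1 ∈ soloInformedEnds u) := by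
  rw [soloInformedWordFn_apply, Fin.val_castSucc, soloInformed_getD_binaryWord u hpos]

/-! ## 3. The `ℕ`-indexed prefix product -/

section pp

variable {m : ℕ}

/-- `P_j(x) = ∏_{i ≤ j} xᵢ` with a natural-number index. -/
def soloInformedPP (x : Fin (m + 1) → ℝ) (j : ℕ) : ℝ :=
  ∏ i ∈ Finset.univ.filter (fun i : Fin (m + 1) => i.1 ≤ j), x i

/-- `P_{i}(x)` at a `Fin` index is the prefix product. -/
theorem soloInformedPP_val (x : Fin (m + 1) → ℝ) (i : Fin (m + 1)) :
    soloInformedPP x i.1 = soloInformedPrefixProd x i := by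
  unfold soloInformedPP soloInformedPrefixProd
  refine Finset.prod_congr ?_ fun _ _ => rfl
  ext l
  simp

/-- The top prefix product. -/
theorem soloInformedPP_last (x : Fin (m + 1) → ℝ) :
    soloInformedPP x m = soloInformedPrefixProd x (Fin.last m) := by
  rw [← soloInformedPP_val, Fin.val_last]

/-- `0 < P_j < 1` on the open cube. -/
theorem soloInformedPP_mem_Ioo {x : Fin (m + 1) → ℝ} (hx : x ∈ soloInformedOpenCube (m + 1)) (j : ℕ) :
    0 < soloInformedPP x j ∧ soloInformedPP x j < 1 := by
  refine ⟨Finset.prod_pos fun i _ => (hx i).1, ?_⟩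
  unfold soloInformedPP
  have h0 : (0 : Fin (m + 1)) ∈ Finset.univ.filter (fun i : Fin (m + 1) => i.1 ≤ j) := by simp
  rw [← Finset.mul_prod_erase _ _ h0]
  have h1 : ∏ i ∈ (Finset.univ.filter (fun i : Fin (m + 1) => i.1 ≤ j)).erase 0, x i ≤ 1 :=
    Finset.prod_le_one (fun i _ => (hx i).1.le) fun i _ => (hx i).2.le
  have h2 : 0 < ∏ i ∈ (Finset.univ.filter (fun i : Fin (m + 1) => i.1 ≤ j)).erase 0, x i :=
    Finset.prod_pos fun i _ => (hx i).1
  nlinarith [(hx 0).1, (hx 0).2]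

end pp

/-! ## 4. The bridge `F_ε = G(Q)` -/

section bridge

variable {m k : ℕ} {u : List ℕ} (hpos : ∀ i ∈ u, 1 ≤ i) (hw : u.sum = m + 1) (hk : u.length = k + 1)
include hpos hw hk

/-- An end below the last one is at most `m`. -/
theorem soloInformed_ends_getD_le_m (r : Fin k) : (soloInformedEnds u).getD r 0 ≤ m := by
  have h := soloInformed_ends_getD_lt hpos (show (r : ℕ) < k from r.2) (by omega)
  rw [soloInformed_ends_getD_last hk, hw] at h
  omega

/-- The positions of the letters `1` below the top, as a map `Fin k → Fin m`. -/
def soloInformedOnePos (r : Fin k) : Fin m :=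
  ⟨(soloInformedEnds u).getD r 0 - 1, by
    have h1 := soloInformed_one_le_ends_getD hpos (show (r : ℕ) < u.length by omega)
    have h2 := soloInformed_ends_getD_le_m hpos hw hk r
    omega⟩

/-- Value of `soloInformedOnePos`. -/
theorem soloInformed_onePos_val (r : Fin k) :
    (soloInformedOnePos hpos hw hk r).1 = (soloInformedEnds u).getD r 0 - 1 := rfl

/-- `soloInformedOnePos` is injective. -/
theorem soloInformed_onePos_injective : Function.Injective (soloInformedOnePos hpos hw hk) := by
  intro r s h
  have hv := congrArg Fin.val h
  rw [soloInformed_onePos_val, soloInformed_onePos_val] at hv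
  have h1 := soloInformed_one_le_ends_getD hpos (show (r : ℕ) < u.length by omega)
  have h2 := soloInformed_one_le_ends_getD hpos (show (s : ℕ) < u.length by omega)
  by_contra hne
  rcases lt_or_gt_of_ne (fun h' => hne (Fin.ext h')) with hlt | hlt
  · have := soloInformed_ends_getD_lt hpos hlt (show (s : ℕ) < u.length by omega); omega
  · have := soloInformed_ends_getD_lt hpos hlt (show (r : ℕ) < u.length by omega); omega

/-- **The letters `1` below the top are exactly the images of `soloInformedOnePos`.** -/
theorem soloInformed_filter_wordFn_eq_image :
    Finset.univ.filter (fun i : Fin m => soloInformedWordFn u m (Fin.castSucc i) = true) =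
      Finset.univ.image (soloInformedOnePos hpos hw hk) := by
  ext i
  simp only [Finset.mem_filter, Finset.mem_univ, true_and, Finset.mem_image,
    soloInformed_wordFn_castSucc hpos, decide_eq_true_eq, soloInformed_mem_ends_iff]
  constructor
  · rintro ⟨r, hr, h⟩
    have hrk : r < k := by
      by_contra hrk
      have : r = k := by omega
      subst this
      rw [soloInformed_ends_getD_last hk, hw] at h
      have := i.2
      omega
    exact ⟨⟨r, hrk⟩, Fin.ext (by rw [soloInformed_onePos_val]; simp only; omega)⟩
  · rintro ⟨r, h⟩
    refine ⟨r, by omega, ?_⟩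
    have hv := congrArg Fin.val h
    rw [soloInformed_onePos_val] at hv
    have h1 := soloInformed_one_le_ends_getD hpos (show (r : ℕ) < u.length by omega)
    omega

/-- **THE BRIDGE.** The cube integrand of the word of `u` is the chain function of the prefix
products at the block ends: `F_{ε(u)}(x) = G(P_{J₁−1}(x), …, P_{J_k−1}(x))`. -/
theorem soloInformed_cubeWf_eq_GQ (x : Fin (m + 1) → ℝ) :
    soloInformedCubeWf (soloInformedWordFn u m) x =
      soloInformedGQ (List.ofFn fun r : Fin (k + 1) =>
        soloInformedPP x ((soloInformedEnds u).getD r 0 - 1)) := by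
  rw [soloInformedGQ_ofFn, soloInformedCubeWf]
  congr 1
  · rw [← Finset.prod_filter, soloInformed_filter_wordFn_eq_image hpos hw hk,
      Finset.prod_image fun r _ s _ h => soloInformed_onePos_injective hpos hw hk h]
    refine Finset.prod_congr rfl fun r _ => ?_
    rw [← soloInformedPP_val]
    rfl
  · rw [Fin.val_last, soloInformed_ends_getD_last hk, hw, Nat.add_sub_cancel, soloInformedPP_last]

/-- The bridge for the representation: the integrand of `CubeW u` is `G` of the prefix products
at the block ends. -/
theorem soloInformed_cubeW_integrand_eq_GQ (hu : MZV.IsAdmissible u) (hw' : MZV.weight u = m + 1)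
    (x : Fin (m + 1) → ℝ) :
    (soloInformedCubeW u hu hw').integrand x =
      soloInformedGQ (List.ofFn fun r : Fin (k + 1) =>
        soloInformedPP x ((soloInformedEnds u).getD r 0 - 1)) := by
  rw [soloInformedCubeW_integrand, soloInformed_cubeWf_eq_GQ hpos hw hk]

end bridge

/-! ## 5. Sanity -/

/-- `ends (2,1,3) = (2,3,6)`. -/
example : soloInformedEnds [2, 1, 3] = [2, 3, 6] := by decide

/-- The word of `(2,1,3)` is `01 1 001`: letters `1` at positions `1, 2, 5 = J_r − 1`. -/
example : (MZV.binaryWord [2, 1, 3]) = [false, true, true, false, false, true] := by decide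

end Summit.KontsevichZagierPeriods.KontsevichZagierPeriods.Theorems
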